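import Literature.Analysis.FluidPDE.TaoEnergyLocalisationProofs
import Summits.NavierStokesRegularity.NavierStokesRegularity.Theorems.TypeICertificateLadderTargetStrainCubeSizes
import Summits.NavierStokesRegularity.NavierStokesRegularity.Theorems.TypeICertificateLadderRungReynoldsOneWeightedSliceTools
import HarnessLib

/-!
# Crux `Target` = `TypeICertificateLadder.NoTypeIBlowup` (stmt-NavierStokesRegularity-1217), line
# `depletion-ladder`: THE STRAIN-CUBE INTERPOLATION `∫|S|³ ≤ ‖v‖_∞ (½‖Δv‖₂‖S‖₂ + ‖S‖₂‖∇S‖₂)`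

`--supports stmt-NavierStokesRegularity-1217` (fourth file of the seat's proof of the depletion
constant `κ = (√3+√6)/9 < 1/2` in the Tao-slice class, hence RUNG TWO of the amplitude ladder).

For a smooth divergence-free `v : ℝ³ → ℝ³` with `|v| ≤ M`, `‖Dv‖ ≤ B`, `D¹v, D²v ∈ L²`
(the Tao-slice class of the rung glue), strain `sᵢⱼ = ½(∂ⱼvᵢ + ∂ᵢvⱼ)`, `q = |S|²_F = Σᵢⱼ sᵢⱼ²`,
`D = |∇S|²_F = Σₗᵢⱼ (∂ₗsᵢⱼ)²`:

  `∫ q √q ≤ M · ( ½ √(∫‖Δv‖²) √(∫q) + √(∫q) √(∫D) )`   (`integral_strainCube_le`).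

Proof (new; the `L^∞`-weighted interpolation that turns Miller's strain-cube bound
`∫⟪ω,Sω⟫ = −4∫det S ≤ (2√6/9)∫|S|³` into a DEPLETION CONSTANT): with the regularised modulus
`N = √(q + ε²) − ε`, integrate by parts entrywise
`∫ q N = Σᵢⱼ ∫ ∂ⱼvᵢ · (sᵢⱼ N) = −Σᵢⱼ ∫ vᵢ ∂ⱼ(sᵢⱼ N)` (no boundary terms: every product is
(bounded) × (L² · L²), Mathlib `integral_mul_fderiv_eq_neg_fderiv_mul_of_integrable`), bound the
integrand by `M (½ N ‖Δv‖ + √q √D)` (previous file), apply Cauchy–Schwarz and `N ≤ √q`, and remove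
`ε` through `q√q ≤ qN + εq`.

WHAT THIS IS NOT: a kinematic inequality for one slice; the depletion constant and the rung follow in
the sequel file. [folklore]
-/

noncomputable section

open Set Function Filter Topology MeasureTheory Finset
open scoped RealInnerProductSpace ENNReal NNReal Laplacian ContDiff
open Literature.Analysis.FluidPDE

namespace Summit.NavierStokesRegularity.NavierStokesRegularity.Theorems.DepletionLadder.StrainCube

-- the problem directory repeats the summit name (`NavierStokesRegularity/NavierStokesRegularity`)
set_option linter.dupNamespace false

open Summit.NavierStokesRegularity.NavierStokesRegularity.Theorems.RungReynoldsOne.WeightedSlice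

variable {v : EuclideanSpace ℝ (Fin 3) → EuclideanSpace ℝ (Fin 3)}
  {s : Fin 3 → Fin 3 → EuclideanSpace ℝ (Fin 3) → ℝ} {N : EuclideanSpace ℝ (Fin 3) → ℝ}

/-! ## Integrability of the products -/

/-- A continuous function bounded by `C ‖Dᵐv‖ ‖Dⁿv‖` with `Dᵐv, Dⁿv ∈ L²` is integrable. [folklore] -/
theorem integrable_of_le_iteratedFDeriv_mul (hv : ContDiff ℝ ∞ v) {m n : ℕ}
    (hm : ∫⁻ x, ‖iteratedFDeriv ℝ m v x‖ₑ ^ 2 < ⊤) (hn : ∫⁻ x, ‖iteratedFDeriv ℝ n v x‖ₑ ^ 2 < ⊤)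
    {φ : EuclideanSpace ℝ (Fin 3) → ℝ} (hφ : Continuous φ) (C : ℝ)
    (hle : ∀ x, |φ x| ≤ C * ‖iteratedFDeriv ℝ m v x‖ * ‖iteratedFDeriv ℝ n v x‖) : Integrable φ := by
  refine integrable_of_norm_le_const_mul_mul C hφ (hv.continuous_iteratedFDeriv (by exact_mod_cast le_top))
    (hv.continuous_iteratedFDeriv (by exact_mod_cast le_top)) hm hn fun x => ?_
  rw [Real.norm_eq_abs]
  exact hle x

/-- The three products of the entrywise integration by parts are integrable, for a smooth weight
`N` with `0 ≤ N ≤ 3‖D¹v‖` and `|∂ₗN| ≤ 6‖D²v‖` (the regularised modulus). [folklore] -/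
theorem integrable_ibp_products (hv : ContDiff ℝ ∞ v) {M B : ℝ} (hM : ∀ x, ‖v x‖ ≤ M)
    (hB : ∀ x, ‖fderiv ℝ v x‖ ≤ B)
    (h1 : ∫⁻ x, ‖iteratedFDeriv ℝ 1 v x‖ₑ ^ 2 < ⊤) (h2 : ∫⁻ x, ‖iteratedFDeriv ℝ 2 v x‖ₑ ^ 2 < ⊤)
    (hs : ∀ i j y, s i j y = (pderiv j (fun z => v z i) y + pderiv i (fun z => v z j) y) / 2)
    (hNC : ContDiff ℝ ∞ N) (hN0 : ∀ x, 0 ≤ N x) (hNle : ∀ x, N x ≤ 3 * ‖iteratedFDeriv ℝ 1 v x‖)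
    (hdN : ∀ l x, |pderiv l N x| ≤ 6 * ‖iteratedFDeriv ℝ 2 v x‖) (i j : Fin 3) :
    Integrable (fun x => pderiv j (fun y => s i j y * N y) x * v x i) ∧
      Integrable (fun x => (s i j x * N x) * pderiv j (fun z => v z i) x) ∧
      Integrable (fun x => (s i j x * N x) * v x i) := by
  have hM0 : 0 ≤ M := (norm_nonneg _).trans (hM 0)
  have hsC := contDiff_sym hv hs
  have hsd : Differentiable ℝ (s i j) := (hsC i j).differentiable (by simp)
  have hNd : Differentiable ℝ N := hNC.differentiable (by simp)
  have cvi : Continuous fun x => v x i := (contDiff_apply_of hv i).continuous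
  have cN : Continuous N := hNC.continuous
  have cs : Continuous (s i j) := (hsC i j).continuous
  have cG : Continuous (pderiv j fun y => s i j y * N y) :=
    (contDiff_pderiv ((hsC i j).mul hNC) j).continuous
  have ca : Continuous (pderiv j fun z => v z i) := (contDiff_grad hv i j).continuous
  have s_le : ∀ x, |s i j x| ≤ ‖iteratedFDeriv ℝ 1 v x‖ := abs_sym_le hv hs i j
  have ds_le : ∀ x, |pderiv j (s i j) x| ≤ ‖iteratedFDeriv ℝ 2 v x‖ := abs_pderiv_sym_le hv hs j i j
  have vi_le : ∀ x, |v x i| ≤ M := fun x => (abs_apply_le_norm x i).trans (hM x)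
  have a_le : ∀ x, |pderiv j (fun z => v z i) x| ≤ ‖iteratedFDeriv ℝ 1 v x‖ := fun x => by
    rw [← norm_fderiv_eq_norm_iteratedFDeriv_one]; exact abs_grad_le_norm_fderiv hv i j x
  have hdG : ∀ x, pderiv j (fun y => s i j y * N y) x = pderiv j (s i j) x * N x + s i j x * pderiv j N x :=
    fun x => by rw [pderiv_mul hsd hNd]
  refine ⟨?_, ?_, ?_⟩
  · refine integrable_of_le_iteratedFDeriv_mul hv h1 h2 (cG.mul cvi) (9 * M) fun x => ?_
    rw [hdG, abs_mul]
    have T10 : 0 ≤ ‖iteratedFDeriv ℝ 1 v x‖ := norm_nonneg _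
    have T20 : 0 ≤ ‖iteratedFDeriv ℝ 2 v x‖ := norm_nonneg _
    have e1 : |pderiv j (s i j) x * N x + s i j x * pderiv j N x| ≤
        9 * ‖iteratedFDeriv ℝ 1 v x‖ * ‖iteratedFDeriv ℝ 2 v x‖ := by
      refine (abs_add_le _ _).trans ?_
      rw [abs_mul, abs_mul, abs_of_nonneg (hN0 x)]
      nlinarith [mul_le_mul (ds_le x) (hNle x) (hN0 x) T20,
        mul_le_mul (s_le x) (hdN j x) (abs_nonneg _) T10]
    calc |pderiv j (s i j) x * N x + s i j x * pderiv j N x| * |v x i|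
        ≤ (9 * ‖iteratedFDeriv ℝ 1 v x‖ * ‖iteratedFDeriv ℝ 2 v x‖) * M :=
          mul_le_mul e1 (vi_le x) (abs_nonneg _) (by positivity)
      _ = 9 * M * ‖iteratedFDeriv ℝ 1 v x‖ * ‖iteratedFDeriv ℝ 2 v x‖ := by ring
  · refine integrable_of_le_iteratedFDeriv_mul hv h1 h1 ((cs.mul cN).mul ca) (3 * B) fun x => ?_
    rw [abs_mul, abs_mul, abs_of_nonneg (hN0 x)]
    have T10 : 0 ≤ ‖iteratedFDeriv ℝ 1 v x‖ := norm_nonneg _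
    have hb : ‖iteratedFDeriv ℝ 1 v x‖ ≤ B := by
      rw [← norm_fderiv_eq_norm_iteratedFDeriv_one]; exact hB x
    calc |s i j x| * N x * |pderiv j (fun z => v z i) x|
        ≤ ‖iteratedFDeriv ℝ 1 v x‖ * (3 * ‖iteratedFDeriv ℝ 1 v x‖) * ‖iteratedFDeriv ℝ 1 v x‖ :=
          mul_le_mul (mul_le_mul (s_le x) (hNle x) (hN0 x) T10) (a_le x) (abs_nonneg _) (by positivity)
      _ ≤ ‖iteratedFDeriv ℝ 1 v x‖ * (3 * ‖iteratedFDeriv ℝ 1 v x‖) * B :=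
          mul_le_mul_of_nonneg_left hb (by positivity)
      _ = 3 * B * ‖iteratedFDeriv ℝ 1 v x‖ * ‖iteratedFDeriv ℝ 1 v x‖ := by ring
  · refine integrable_of_le_iteratedFDeriv_mul hv h1 h1 ((cs.mul cN).mul cvi) (3 * M) fun x => ?_
    rw [abs_mul, abs_mul, abs_of_nonneg (hN0 x)]
    have T10 : 0 ≤ ‖iteratedFDeriv ℝ 1 v x‖ := norm_nonneg _
    calc |s i j x| * N x * |v x i|
        ≤ ‖iteratedFDeriv ℝ 1 v x‖ * (3 * ‖iteratedFDeriv ℝ 1 v x‖) * M :=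
          mul_le_mul (mul_le_mul (s_le x) (hNle x) (hN0 x) T10) (vi_le x) (abs_nonneg _) (by positivity)
      _ = 3 * M * ‖iteratedFDeriv ℝ 1 v x‖ * ‖iteratedFDeriv ℝ 1 v x‖ := by ring


/-! ## The identity `∫ q N = −∫ Σᵢⱼ ∂ⱼ(sᵢⱼN) vᵢ` -/

/-- **Entrywise integration by parts, summed**: for the strain `s` of a smooth divergence-free field
in the slice class and a smooth weight `N` as above,
`∫ q N = −∫ Σᵢⱼ ∂ⱼ(sᵢⱼ N) vᵢ` (`q = Σᵢⱼ sᵢⱼ²`, `Σᵢⱼ ∂ⱼvᵢ sᵢⱼ = q`). [folklore] -/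
theorem integral_sumSq_mul_weight_eq (hv : ContDiff ℝ ∞ v) {M B : ℝ} (hM : ∀ x, ‖v x‖ ≤ M)
    (hB : ∀ x, ‖fderiv ℝ v x‖ ≤ B)
    (h1 : ∫⁻ x, ‖iteratedFDeriv ℝ 1 v x‖ₑ ^ 2 < ⊤) (h2 : ∫⁻ x, ‖iteratedFDeriv ℝ 2 v x‖ₑ ^ 2 < ⊤)
    (hs : ∀ i j y, s i j y = (pderiv j (fun z => v z i) y + pderiv i (fun z => v z j) y) / 2)
    (hNC : ContDiff ℝ ∞ N) (hN0 : ∀ x, 0 ≤ N x) (hNle : ∀ x, N x ≤ 3 * ‖iteratedFDeriv ℝ 1 v x‖)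
    (hdN : ∀ l x, |pderiv l N x| ≤ 6 * ‖iteratedFDeriv ℝ 2 v x‖) :
    ∫ x, (∑ i, ∑ j, s i j x ^ 2) * N x =
      -∫ x, ∑ i, ∑ j, pderiv j (fun y => s i j y * N y) x * v x i := by
  have P := integrable_ibp_products hv hM hB h1 h2 hs hNC hN0 hNle hdN
  have hsd : ∀ i j, Differentiable ℝ (s i j) := fun i j => (contDiff_sym hv hs i j).differentiable (by simp)
  have hNd : Differentiable ℝ N := hNC.differentiable (by simp)
  have hvd : ∀ i, Differentiable ℝ fun y => v y i := fun i => (contDiff_apply_of hv i).differentiable (by simp)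
  -- entrywise integration by parts
  have ibp : ∀ i j, ∫ x, (s i j x * N x) * pderiv j (fun z => v z i) x =
      -∫ x, pderiv j (fun y => s i j y * N y) x * v x i := by
    intro i j
    obtain ⟨hP1, hP2, hP3⟩ := P i j
    simp only [pderiv_apply] at hP1 hP2 ⊢
    exact integral_mul_fderiv_eq_neg_fderiv_mul_of_integrable hP1 hP2 hP3
      (fun x _ => ((hsd i j).mul hNd) x) (fun x _ => hvd i x)
  -- pointwise: `q N = Σᵢⱼ (sᵢⱼ N) ∂ⱼvᵢ`
  have hpt : ∀ x, (∑ i, ∑ j, s i j x ^ 2) * N x = ∑ i, ∑ j, (s i j x * N x) * pderiv j (fun z => v z i) x := by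
    intro x
    rw [← sum_mul_sym_eq (fun i j => pderiv j (fun z => v z i) x) (fun i j => s i j x) (fun i j => hs i j x),
      Finset.sum_mul]
    refine Finset.sum_congr rfl fun i _ => ?_
    rw [Finset.sum_mul]
    exact Finset.sum_congr rfl fun j _ => by ring
  simp_rw [hpt]
  rw [integral_finsetSum _ (fun i _ => integrable_finsetSum _ fun j _ => (P i j).2.1),
    integral_finsetSum _ (fun i _ => integrable_finsetSum _ fun j _ => (P i j).1),
    ← Finset.sum_neg_distrib]
  refine Finset.sum_congr rfl fun i _ => ?_
  rw [integral_finsetSum _ (fun j _ => (P i j).2.1), integral_finsetSum _ (fun j _ => (P i j).1),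
    ← Finset.sum_neg_distrib]
  exact Finset.sum_congr rfl fun j _ => ibp i j

/-! ## The bound on `∫ q N` -/

/-- **`∫ q N ≤ M (½ √(∫‖Δv‖²) √(∫q) + √(∫q) √(∫D))`** for a smooth weight `N` with
`0 ≤ N ≤ √q`, `N ≤ 3‖D¹v‖`, `|∂ₗN| ≤ 6‖D²v‖`, `Σₗ (∂ₗN)² ≤ D`. [folklore] -/
theorem integral_sumSq_mul_weight_le (hv : ContDiff ℝ ∞ v) (hdiv : VectorCalculus.IsDivFree v)
    {M B : ℝ} (hM : ∀ x, ‖v x‖ ≤ M) (hB : ∀ x, ‖fderiv ℝ v x‖ ≤ B)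
    (h1 : ∫⁻ x, ‖iteratedFDeriv ℝ 1 v x‖ₑ ^ 2 < ⊤) (h2 : ∫⁻ x, ‖iteratedFDeriv ℝ 2 v x‖ₑ ^ 2 < ⊤)
    (hs : ∀ i j y, s i j y = (pderiv j (fun z => v z i) y + pderiv i (fun z => v z j) y) / 2)
    (hNC : ContDiff ℝ ∞ N) (hN0 : ∀ x, 0 ≤ N x)
    (hNq : ∀ x, N x ≤ Real.sqrt (∑ i, ∑ j, s i j x ^ 2))
    (hNle : ∀ x, N x ≤ 3 * ‖iteratedFDeriv ℝ 1 v x‖)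
    (hdN : ∀ l x, |pderiv l N x| ≤ 6 * ‖iteratedFDeriv ℝ 2 v x‖)
    (hdND : ∀ x, ∑ l, pderiv l N x ^ 2 ≤ ∑ l, ∑ i, ∑ j, pderiv l (s i j) x ^ 2) :
    ∫ x, (∑ i, ∑ j, s i j x ^ 2) * N x ≤
      M * ((1 / 2) * Real.sqrt (∫ x, ‖(Δ v) x‖ ^ 2) * Real.sqrt (∫ x, ∑ i, ∑ j, s i j x ^ 2) +
        Real.sqrt (∫ x, ∑ i, ∑ j, s i j x ^ 2) *
          Real.sqrt (∫ x, ∑ l, ∑ i, ∑ j, pderiv l (s i j) x ^ 2)) := by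
  have hM0 : 0 ≤ M := (norm_nonneg _).trans (hM 0)
  have hsC := contDiff_sym hv hs
  have hNd : Differentiable ℝ N := hNC.differentiable (by simp)
  have cN : Continuous N := hNC.continuous
  -- everything involving the Laplacian, then generalize it away
  have cL : Continuous (Δ v) := continuous_laplacian_of hv
  have L_le : ∀ x, ‖(Δ v) x‖ ≤ 6 * ‖iteratedFDeriv ℝ 2 v x‖ := norm_laplacian_le hv
  have hpt : ∀ x, -(∑ i, ∑ j, pderiv j (fun y => s i j y * N y) x * v x i) ≤
      M * ((1 / 2) * (N x * ‖(Δ v) x‖) +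
        Real.sqrt (∑ i, ∑ j, s i j x ^ 2) * Real.sqrt (∑ l, ∑ i, ∑ j, pderiv l (s i j) x ^ 2)) :=
    fun x => neg_sum_pderiv_mul_weight_le hv hdiv hs hNd x (hM x) (hN0 x) (hdND x)
  rw [integral_sumSq_mul_weight_eq hv hM hB h1 h2 hs hNC hN0 hNle hdN, ← integral_neg]
  generalize Δ v = L at cL L_le hpt ⊢
  set q : EuclideanSpace ℝ (Fin 3) → ℝ := fun x => ∑ i, ∑ j, s i j x ^ 2 with hq
  set D : EuclideanSpace ℝ (Fin 3) → ℝ := fun x => ∑ l, ∑ i, ∑ j, pderiv l (s i j) x ^ 2 with hD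
  have cq : Continuous q := continuous_finsetSum _ fun i _ => continuous_finsetSum _ fun j _ =>
    ((hsC i j).continuous).pow 2
  have cD : Continuous D := continuous_finsetSum _ fun l _ => continuous_finsetSum _ fun i _ =>
    continuous_finsetSum _ fun j _ => ((contDiff_pderiv (hsC i j) l).continuous).pow 2
  have hq0 : ∀ x, 0 ≤ q x := fun x => sumSq_nonneg (s := s) x
  have hD0 : ∀ x, 0 ≤ D x := fun x =>
    sum_nonneg fun l _ => sumSq_nonneg (s := fun i j y => pderiv l (s i j) y) x
  -- integrability
  have P := integrable_ibp_products hv hM hB h1 h2 hs hNC hN0 hNle hdN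
  have iq : Integrable q := by
    refine integrable_of_le_iteratedFDeriv_mul hv h1 h1 cq 9 fun x => ?_
    rw [abs_of_nonneg (hq0 x)]
    nlinarith [sumSq_sym_le hv hs x]
  have iD : Integrable D := by
    refine integrable_of_le_iteratedFDeriv_mul hv h2 h2 cD 27 fun x => ?_
    rw [abs_of_nonneg (hD0 x)]
    nlinarith [gradSq_sym_le hv hs x]
  have iL2 : Integrable fun x => ‖L x‖ ^ 2 := by
    refine integrable_of_le_iteratedFDeriv_mul hv h2 h2 (cL.norm.pow 2) 36 fun x => ?_
    rw [abs_of_nonneg (sq_nonneg _)]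
    nlinarith [L_le x, norm_nonneg (L x)]
  have iNL : Integrable fun x => N x * ‖L x‖ := by
    refine integrable_of_le_iteratedFDeriv_mul hv h1 h2 (cN.mul cL.norm) 18 fun x => ?_
    rw [abs_mul, abs_of_nonneg (hN0 x), abs_of_nonneg (norm_nonneg _)]
    nlinarith [mul_le_mul (hNle x) (L_le x) (norm_nonneg _)
      (by positivity : (0:ℝ) ≤ 3 * ‖iteratedFDeriv ℝ 1 v x‖)]
  have iqD : Integrable fun x => Real.sqrt (q x) * Real.sqrt (D x) := by
    refine integrable_of_le_iteratedFDeriv_mul hv h1 h2 ((Real.continuous_sqrt.comp cq).mul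
      (Real.continuous_sqrt.comp cD)) 18 fun x => ?_
    rw [abs_mul, abs_of_nonneg (Real.sqrt_nonneg _), abs_of_nonneg (Real.sqrt_nonneg _)]
    nlinarith [mul_le_mul (sqrt_sumSq_sym_le hv hs x) (sqrt_gradSq_sym_le hv hs x) (Real.sqrt_nonneg _)
      (by positivity : (0:ℝ) ≤ 3 * ‖iteratedFDeriv ℝ 1 v x‖)]
  have iS : Integrable fun x => ∑ i, ∑ j, pderiv j (fun y => s i j y * N y) x * v x i :=
    integrable_finsetSum _ fun i _ => integrable_finsetSum _ fun j _ => (P i j).1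
  have iS' : Integrable fun x => -(∑ i, ∑ j, pderiv j (fun y => s i j y * N y) x * v x i) := iS.neg
  have iR : Integrable fun x => M * ((1 / 2) * (N x * ‖L x‖) + Real.sqrt (q x) * Real.sqrt (D x)) :=
    ((iNL.const_mul _).add iqD).const_mul M
  have step1 : ∫ x, -(∑ i, ∑ j, pderiv j (fun y => s i j y * N y) x * v x i) ≤
      M * ((1 / 2) * (∫ x, N x * ‖L x‖) + ∫ x, Real.sqrt (q x) * Real.sqrt (D x)) := by
    have h := integral_mono iS' iR hpt
    refine h.trans_eq ?_
    rw [integral_const_mul, integral_add (iNL.const_mul _) iqD, integral_const_mul]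
  -- Cauchy–Schwarz
  have N2_le : ∀ x, N x ^ 2 ≤ q x := fun x => by
    calc N x ^ 2 ≤ Real.sqrt (q x) ^ 2 := pow_le_pow_left₀ (hN0 x) (hNq x) 2
      _ = q x := Real.sq_sqrt (hq0 x)
  have iN2 : Integrable fun x => N x ^ 2 := by
    refine iq.mono' (cN.pow 2).aestronglyMeasurable (Eventually.of_forall fun x => ?_)
    rw [Real.norm_of_nonneg (sq_nonneg _)]
    exact N2_le x
  have isq2 : Integrable fun x => Real.sqrt (q x) ^ 2 :=
    iq.congr (Eventually.of_forall fun x => (Real.sq_sqrt (hq0 x)).symm)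
  have isD2 : Integrable fun x => Real.sqrt (D x) ^ 2 :=
    iD.congr (Eventually.of_forall fun x => (Real.sq_sqrt (hD0 x)).symm)
  have cs1 : ∫ x, N x * ‖L x‖ ≤ Real.sqrt (∫ x, q x) * Real.sqrt (∫ x, ‖L x‖ ^ 2) := by
    have h := integral_mul_le_sqrt_mul_sqrt (μ := volume) hN0 (fun x => norm_nonneg (L x))
      cN.aestronglyMeasurable cL.norm.aestronglyMeasurable iN2 iL2
    refine h.trans (mul_le_mul_of_nonneg_right (Real.sqrt_le_sqrt ?_) (Real.sqrt_nonneg _))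
    exact integral_mono iN2 iq N2_le
  have cs2 : ∫ x, Real.sqrt (q x) * Real.sqrt (D x) ≤ Real.sqrt (∫ x, q x) * Real.sqrt (∫ x, D x) := by
    have h := integral_mul_le_sqrt_mul_sqrt (μ := volume) (fun x => Real.sqrt_nonneg (q x))
      (fun x => Real.sqrt_nonneg (D x)) (Real.continuous_sqrt.comp cq).aestronglyMeasurable
      (Real.continuous_sqrt.comp cD).aestronglyMeasurable isq2 isD2
    have e1 : ∫ x, Real.sqrt (q x) ^ 2 = ∫ x, q x :=
      integral_congr_ae (Eventually.of_forall fun x => Real.sq_sqrt (hq0 x))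
    have e2 : ∫ x, Real.sqrt (D x) ^ 2 = ∫ x, D x :=
      integral_congr_ae (Eventually.of_forall fun x => Real.sq_sqrt (hD0 x))
    rw [e1, e2] at h
    exact h
  have hsq0 : 0 ≤ Real.sqrt (∫ x, q x) := Real.sqrt_nonneg _
  have hL0 : 0 ≤ Real.sqrt (∫ x, ‖L x‖ ^ 2) := Real.sqrt_nonneg _
  calc ∫ x, -(∑ i, ∑ j, pderiv j (fun y => s i j y * N y) x * v x i)
      ≤ M * ((1 / 2) * (∫ x, N x * ‖L x‖) + ∫ x, Real.sqrt (q x) * Real.sqrt (D x)) := step1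
    _ ≤ M * ((1 / 2) * (Real.sqrt (∫ x, q x) * Real.sqrt (∫ x, ‖L x‖ ^ 2)) +
          Real.sqrt (∫ x, q x) * Real.sqrt (∫ x, D x)) :=
        mul_le_mul_of_nonneg_left (by linarith [cs1, cs2]) hM0
    _ = M * ((1 / 2) * Real.sqrt (∫ x, ‖L x‖ ^ 2) * Real.sqrt (∫ x, q x) +
          Real.sqrt (∫ x, q x) * Real.sqrt (∫ x, D x)) := by ring

/-! ## The interpolation inequality -/

/-- **The strain-cube interpolation.** For a smooth divergence-free field `v` on `ℝ³` with
`|v| ≤ M`, `‖Dv‖ ≤ B` and `D¹v, D²v ∈ L²`, and its strain `sᵢⱼ = ½(∂ⱼvᵢ + ∂ᵢvⱼ)`: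
`∫ q√q ≤ M (½ √(∫‖Δv‖²) √(∫q) + √(∫q) √(∫ Σₗᵢⱼ(∂ₗsᵢⱼ)²))`, `q = Σᵢⱼ sᵢⱼ²`. Proof: the previous
bound for the regularised modulus `N = √(q+ε²) − ε` and `q√q ≤ qN + εq`, `ε → 0`. [folklore] -/
theorem integral_strainCube_le (hv : ContDiff ℝ ∞ v) (hdiv : VectorCalculus.IsDivFree v)
    {M B : ℝ} (hM : ∀ x, ‖v x‖ ≤ M) (hB : ∀ x, ‖fderiv ℝ v x‖ ≤ B)
    (h1 : ∫⁻ x, ‖iteratedFDeriv ℝ 1 v x‖ₑ ^ 2 < ⊤) (h2 : ∫⁻ x, ‖iteratedFDeriv ℝ 2 v x‖ₑ ^ 2 < ⊤)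
    (hs : ∀ i j y, s i j y = (pderiv j (fun z => v z i) y + pderiv i (fun z => v z j) y) / 2) :
    ∫ x, (∑ i, ∑ j, s i j x ^ 2) * Real.sqrt (∑ i, ∑ j, s i j x ^ 2) ≤
      M * ((1 / 2) * Real.sqrt (∫ x, ‖(Δ v) x‖ ^ 2) * Real.sqrt (∫ x, ∑ i, ∑ j, s i j x ^ 2) +
        Real.sqrt (∫ x, ∑ i, ∑ j, s i j x ^ 2) *
          Real.sqrt (∫ x, ∑ l, ∑ i, ∑ j, pderiv l (s i j) x ^ 2)) := by
  set q : EuclideanSpace ℝ (Fin 3) → ℝ := fun x => ∑ i, ∑ j, s i j x ^ 2 with hq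
  set R : ℝ := M * ((1 / 2) * Real.sqrt (∫ x, ‖(Δ v) x‖ ^ 2) * Real.sqrt (∫ x, q x) +
        Real.sqrt (∫ x, q x) * Real.sqrt (∫ x, ∑ l, ∑ i, ∑ j, pderiv l (s i j) x ^ 2)) with hR
  have hsC := contDiff_sym hv hs
  have hq0 : ∀ x, 0 ≤ q x := fun x => sumSq_nonneg (s := s) x
  have cq : Continuous q := continuous_finsetSum _ fun i _ => continuous_finsetSum _ fun j _ =>
    ((hsC i j).continuous).pow 2
  have hB' : ∀ x, ‖iteratedFDeriv ℝ 1 v x‖ ≤ B := fun x => by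
    rw [← norm_fderiv_eq_norm_iteratedFDeriv_one]; exact hB x
  have iq : Integrable q := by
    refine integrable_of_le_iteratedFDeriv_mul hv h1 h1 cq 9 fun x => ?_
    rw [abs_of_nonneg (hq0 x)]
    nlinarith [sumSq_sym_le hv hs x]
  have iq32 : Integrable fun x => q x * Real.sqrt (q x) := by
    refine integrable_of_le_iteratedFDeriv_mul hv h1 h1 (cq.mul (Real.continuous_sqrt.comp cq)) (27 * B)
      fun x => ?_
    rw [abs_mul, abs_of_nonneg (hq0 x), abs_of_nonneg (Real.sqrt_nonneg _)]
    have T0 : 0 ≤ ‖iteratedFDeriv ℝ 1 v x‖ := norm_nonneg _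
    calc q x * Real.sqrt (q x) ≤ (9 * ‖iteratedFDeriv ℝ 1 v x‖ ^ 2) * (3 * ‖iteratedFDeriv ℝ 1 v x‖) :=
          mul_le_mul (sumSq_sym_le hv hs x) (sqrt_sumSq_sym_le hv hs x) (Real.sqrt_nonneg _) (by positivity)
      _ = (27 * ‖iteratedFDeriv ℝ 1 v x‖ * ‖iteratedFDeriv ℝ 1 v x‖) * ‖iteratedFDeriv ℝ 1 v x‖ := by ring
      _ ≤ (27 * ‖iteratedFDeriv ℝ 1 v x‖ * ‖iteratedFDeriv ℝ 1 v x‖) * B :=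
          mul_le_mul_of_nonneg_left (hB' x) (by positivity)
      _ = 27 * B * ‖iteratedFDeriv ℝ 1 v x‖ * ‖iteratedFDeriv ℝ 1 v x‖ := by ring
  -- the bound for every `ε > 0`
  have key : ∀ ε : ℝ, 0 < ε → ∫ x, q x * Real.sqrt (q x) ≤ R + ε * ∫ x, q x := by
    intro ε hε
    set N : EuclideanSpace ℝ (Fin 3) → ℝ := fun x => Real.sqrt (q x + ε ^ 2) - ε with hN
    have hNC : ContDiff ℝ ∞ N := contDiff_regMod hsC hε
    have hN0 : ∀ x, 0 ≤ N x := fun x => regMod_nonneg (s := s) hε x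
    have hNq : ∀ x, N x ≤ Real.sqrt (q x) := fun x => regMod_le_sqrt (s := s) hε x
    have hNle : ∀ x, N x ≤ 3 * ‖iteratedFDeriv ℝ 1 v x‖ := fun x =>
      (hNq x).trans (sqrt_sumSq_sym_le hv hs x)
    have hdND : ∀ x, ∑ l, pderiv l N x ^ 2 ≤ ∑ l, ∑ i, ∑ j, pderiv l (s i j) x ^ 2 := fun x =>
      Finset.sum_le_sum fun l _ => sq_pderiv_regMod_le hsC hε l x
    have hdN : ∀ l x, |pderiv l N x| ≤ 6 * ‖iteratedFDeriv ℝ 2 v x‖ := fun l x => by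
      refine (abs_pderiv_regMod_le hsC hε l x).trans ((Real.sqrt_le_sqrt ?_).trans (sqrt_gradSq_sym_le hv hs x))
      exact Finset.single_le_sum (f := fun l => ∑ i, ∑ j, pderiv l (s i j) x ^ 2)
        (fun l _ => sumSq_nonneg (s := fun i j y => pderiv l (s i j) y) x) (Finset.mem_univ l)
    have main := integral_sumSq_mul_weight_le hv hdiv hM hB h1 h2 hs hNC hN0 hNq hNle hdN hdND
    have cN : Continuous N := hNC.continuous
    have iqN : Integrable fun x => q x * N x := by
      refine iq32.mono' (cq.mul cN).aestronglyMeasurable (Eventually.of_forall fun x => ?_)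
      rw [Real.norm_eq_abs, abs_mul, abs_of_nonneg (hq0 x), abs_of_nonneg (hN0 x)]
      exact mul_le_mul_of_nonneg_left (hNq x) (hq0 x)
    have iSum : Integrable fun x => q x * N x + ε * q x := iqN.add (iq.const_mul ε)
    have hsum : ∫ x, (q x * N x + ε * q x) = (∫ x, q x * N x) + ε * ∫ x, q x := by
      rw [integral_add iqN (iq.const_mul ε), integral_const_mul]
    have step0 : ∫ x, q x * Real.sqrt (q x) ≤ (∫ x, q x * N x) + ε * ∫ x, q x := by
      rw [← hsum]
      refine integral_mono (f := fun x => q x * Real.sqrt (q x)) (g := fun x => q x * N x + ε * q x)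
        iq32 iSum fun x => ?_
      have h := sqrt_sub_regMod_le (s := s) (ε := ε) x
      have hqx := hq0 x
      change q x * Real.sqrt (q x) ≤ q x * N x + ε * q x
      nlinarith
    have main' : ∫ x, q x * N x ≤ R := main
    linarith [main']
  -- let `ε → 0`
  have hQ : 0 ≤ ∫ x, q x := integral_nonneg hq0
  refine le_of_forall_pos_le_add fun δ hδ => ?_
  have h := key (δ / ((∫ x, q x) + 1)) (by positivity)
  have : δ / ((∫ x, q x) + 1) * ∫ x, q x ≤ δ := by
    rw [div_mul_eq_mul_div, div_le_iff₀ (by positivity)]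
    nlinarith
  linarith

end Summit.NavierStokesRegularity.NavierStokesRegularity.Theorems.DepletionLadder.StrainCube

end
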